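import Summits.CriticalPhenomena.PercolationContinuityZ3.Theorems.Transplant.FKConnectivityAllQForestSeriesEndTools
import HarnessLib

/-!
# The SERIES REDUCTION at the end `v` of `e` (assembly): a level-free step of the vertex-elimination induction for the adjacent forest node

(Part 2 of 2; the local facts, the toggle step `seriesEnd_second_eq` and the set bookkeeping are in `…ForestSeriesEndTools`.)

Support file (`--supports stmt-CriticalPhenomena-4575`), FK sub-lane `prim-bschramm-fk-1` (generation 30) of the post-continuity
programme; builds on p205010 (kernel theorem, internal audit signed; external expert review pending).  No definitions, no named facts,
no sorries; standard axioms.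

SETTING: a fibre `(M₁ ∪ {g}, u)` of the node (♣)⁰ = `AdjForestRayleighNoSqOn` at the hub `o` (`e = ov`, `f = oy ∈ M₁` free) in which the
end `v` of `e` carries exactly the two free pairs `e` and `g = vw` (`w ∉ {o, v, y}`).  Splitting by the class of `g`:
* `g` in the SECOND class (`v` a leaf of both classes): the bad and the good colourings are EQUINUMEROUS — on the rest fibre `(M₁, u)` the
  vertex `v` is a leaf hanging on `o`, both partners absorb `e`, and g30's e-toggle (`adjForestNoSq_bad_absorb_eq_good_absorb`) applies
  (**`seriesEnd_second_eq`**);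
* `g` in the FIRST class (path `w – v – o` there, `v` isolated in the partner): replacing the path by the single pair `ow` is a bijection
  onto the colourings of the REDUCED fibre with hub pairs `ow, f` — `(M₁ ∖ {e} ∪ {ow}, u)` if `ow` is not a pair of the fibre
  (**`seriesEnd_first_eq_new`**), the pinned fibre `(M₁ ∖ {e, ow}, u ∪ {ow})` if `ow ∈ M₁` (**`seriesEnd_first_eq_free`**), and nothing if
  `ow` is pinned (a triangle `o v w` in one class);
so (**`adjForestNoSq_fibre_of_seriesEnd`**) the node on the fibre follows from the node on ONE reduced fibre over the support minus `v`.
This is CHLW's Case 2(ii) at all levels; it is the step of the induction 'H1′ (`TwoCellBoundOn`) ⇒ node' (memo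
bschramm/FROM-fk-1-g30-LAMAN-IDENTITIES.md §4) at an end of weighted degree two.
[cite: CibulkaHladkyLaCroixWagner2008, Thm. 1 (p. 2), Case 2(ii) (p. 4)] [cite: SempleWelsh2008, Conj. 1.1 (p. 2)] [cite: Linusson2011, Prop. 2.6]
[cite: Grimmett2006, §1.5 (p. 13)]
-/

noncomputable section

namespace Summit.CriticalPhenomena.PercolationContinuityZ3.Theorems
namespace FK

open MeasureTheory Set Literature.Probability.LatticeModels Literature.Probability.Percolation
open scoped Classical symmDiff

variable {V : Type*} [Fintype V]

section SeriesEnd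

variable {M₁ u : BondConfig V} {o v y w : V}

/-- **`g` first, `h = ow` NOT a pair of the fibre: the series bijection** `ω ↦ (ω ∖ {e}) ∪ {h}` between the `g`-first colourings
of `(M₁ ∪ {g}, u)` (read on the rest `(M₁, u)`) and the colourings of the reduced fibre `(M₁ ∖ {e} ∪ {h}, u)` containing `h`; the
partner class is unchanged.  `P₀` is any configuration event blind to `e` and `h`.
[cite: CibulkaHladkyLaCroixWagner2008, Case 2(ii) (p. 4)] [cite: Linusson2011, Prop. 2.6] -/
theorem seriesEnd_first_eq_new (hov : o ≠ v) (hvw : v ≠ w) (how : o ≠ w) (heM : s(o, v) ∈ M₁) (hd : Disjoint u M₁)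
    (hv : ∀ p ∈ M₁ ∪ u, v ∈ p → p = s(o, v)) (hhM : s(o, w) ∉ M₁) (hhu : s(o, w) ∉ u)
    (P₀ Q : Set (BondConfig V))
    (hP₀ : ∀ ω ω' : BondConfig V, (∀ p, p ≠ s(o, v) → p ≠ s(o, w) → (p ∈ ω ↔ p ∈ ω')) → (ω ∈ P₀ ↔ ω' ∈ P₀)) :
    fibreCount M₁ u ({ω | s(v, w) ∉ ω} ∩ ({ω | insert s(v, w) ω ∈ forestEv V} ∩ {ω | s(o, v) ∈ ω} ∩ P₀))
        ({ω | s(v, w) ∉ ω} ∩ (forestEv V ∩ Q)) =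
      fibreCount (insert s(o, w) (M₁ \ {s(o, v)})) u (forestEv V ∩ {ω | s(o, w) ∈ ω} ∩ P₀) (forestEv V ∩ Q) := by
  have heu : s(o, v) ∉ u := fun h => Set.disjoint_left.1 hd h heM
  have heh : s(o, v) ≠ s(o, w) := fun h => hvw (Sym2.congr_right.1 h)
  have hge : s(v, w) ≠ s(o, v) := fun h => by
    have : w ∈ s(o, v) := h ▸ Sym2.mem_mk_right _ _
    rcases Sym2.mem_iff.1 this with h' | h'
    · exact how h'.symm
    · exact hvw h'.symm
  -- pairs at `v` in the reduced fibre: none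
  have hv'' : ∀ p ∈ insert s(o, w) (M₁ \ {s(o, v)}) ∪ u, v ∉ p := by
    intro p hp hvp
    rcases hp with hp | hp
    · rcases mem_insert_iff.1 hp with rfl | hp
      · rcases Sym2.mem_iff.1 hvp with h | h
        · exact hov h.symm
        · exact hvw h
      · exact hp.2 (hv p (Or.inl hp.1) hvp)
    · exact heu ((hv p (Or.inr hp) hvp) ▸ hp)
  refine fibreCount_eq_of_bij (fun ω => insert s(o, w) (ω \ {s(o, v)})) (fun ω => insert s(o, v) (ω \ {s(o, w)}))
    (fun ω hω hA hB => ?_) (fun ω hω hA hB => ?_)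
  · -- forward
    obtain ⟨hgω, ⟨hgF, heω⟩, hP⟩ := hA
    obtain ⟨-, hBF, hBQ⟩ := hB
    have hgω : s(v, w) ∉ ω := hgω
    have heω : s(o, v) ∈ ω := heω
    have hgF : insert s(v, w) ω ∈ forestEv V := hgF
    have hsub := subset_union_of_fibre hω
    have hhω : s(o, w) ∉ ω := fun h => (hsub.1 h).elim hhM hhu
    have hve := end_only_of_fibre hv hω
    have hωF : ω ∈ forestEv V := ((insert_mem_forestEv_iff hvw hgω).1 hgF).1
    have hvw' : ¬ (openGraph ω).Reachable v w := ((insert_mem_forestEv_iff hvw hgω).1 hgF).2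
    have how' : ¬ (openGraph (ω \ {s(o, v)})).Reachable o w := fun h =>
      hvw' ((reachable_end_iff hve heω w).2 (Or.inr h))
    have hF' : insert s(o, w) (ω \ {s(o, v)}) ∈ forestEv V :=
      (insert_mem_forestEv_iff how (fun h => hhω h.1)).2 ⟨forestEv_of_subset hωF sdiff_subset, how'⟩
    have hagree : ∀ p, p ≠ s(o, v) → p ≠ s(o, w) → (p ∈ ω ↔ p ∈ insert s(o, w) (ω \ {s(o, v)})) :=
      fun p hpe hph => (mem_seriesMap_iff hpe hph).symm
    refine ⟨?_, ⟨⟨hF', mem_insert _ _⟩, (hP₀ _ _ hagree).1 hP⟩, ?_, seriesMap_cancel ω heω hhω heh⟩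
    · rw [seriesMap_sdiff ω heω heM hhω hhM, hω]
    · rw [seriesMap_symmDiff ω heω heM hhω hhM]; exact ⟨hBF, hBQ⟩
  · -- backward
    obtain ⟨⟨hF'', hhω⟩, hP⟩ := hA
    obtain ⟨hBF, hBQ⟩ := hB
    have hhω : s(o, w) ∈ ω := hhω
    have hsub := subset_union_of_fibre hω
    have heω'' : s(o, v) ∉ ω := fun h => by
      rcases hsub.1 h with h' | h'
      · rcases mem_insert_iff.1 h' with h'' | h''
        · exact heh h''
        · exact h''.2 rfl
      · exact heu h'
    have hgω'' : s(v, w) ∉ ω := fun h => hv'' _ (hsub.1 h) (Sym2.mem_mk_left _ _)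
    have hviso : ∀ p ∈ ω \ {s(o, w)}, v ∉ p := fun p hp => hv'' p (hsub.1 hp.1)
    have hψF₀ : ω \ {s(o, w)} ∈ forestEv V := forestEv_of_subset hF'' sdiff_subset
    have hψF : insert s(o, v) (ω \ {s(o, w)}) ∈ forestEv V := by
      have := (isForestCfg_insert_of_isolated hviso hov.symm).2 hψF₀
      rwa [Sym2.eq_swap] at this
    have hωeq : insert s(o, w) (ω \ {s(o, w)}) = ω := by rw [insert_sdiff_singleton, insert_eq_of_mem hhω]
    have how' : ¬ (openGraph (ω \ {s(o, w)})).Reachable o w :=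
      ((insert_mem_forestEv_iff how (fun h => h.2 rfl)).1 (hωeq.symm ▸ hF'')).2
    have hve : ∀ p ∈ insert s(o, v) (ω \ {s(o, w)}), v ∈ p → p = s(o, v) := by
      intro p hp hvp
      rcases mem_insert_iff.1 hp with rfl | hp
      · rfl
      · exact absurd hvp (hviso p hp)
    have hge' : s(v, w) ∉ insert s(o, v) (ω \ {s(o, w)}) := fun h => by
      rcases mem_insert_iff.1 h with h | h
      · exact hge h
      · exact hgω'' h.1
    have hrest : insert s(o, v) (ω \ {s(o, w)}) \ {s(o, v)} = ω \ {s(o, w)} := by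
      rw [insert_sdiff_of_mem _ (mem_singleton (s(o, v))), sdiff_singleton_eq_self]
      exact fun h => heω'' h.1
    have hgF : insert s(v, w) (insert s(o, v) (ω \ {s(o, w)})) ∈ forestEv V := by
      refine (insert_mem_forestEv_iff hvw hge').2 ⟨hψF, fun hR => ?_⟩
      rcases (reachable_end_iff hve (mem_insert _ _) w).1 hR with h | h
      · exact hvw h.symm
      · rw [hrest] at h
        exact how' h
    have hagree : ∀ p, p ≠ s(o, v) → p ≠ s(o, w) → (p ∈ insert s(o, v) (ω \ {s(o, w)}) ↔ p ∈ ω) :=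
      fun p hpe hph => mem_seriesMap_iff hph hpe
    refine ⟨?_, ⟨hge', ⟨hgF, mem_insert _ _⟩, (hP₀ _ _ hagree).2 hP⟩, ?_, seriesMap_cancel ω hhω heω'' heh.symm⟩
    · -- fibre
      have hhM'' : s(o, v) ∉ insert s(o, w) (M₁ \ {s(o, v)}) := fun h => by
        rcases mem_insert_iff.1 h with h | h
        · exact heh h
        · exact h.2 rfl
      have h1 := seriesMap_sdiff (M₁ := insert s(o, w) (M₁ \ {s(o, v)})) ω hhω (mem_insert _ _) heω'' hhM''
      rw [seriesMap_cancel M₁ heM hhM heh] at h1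
      rw [h1, hω]
    · -- partner
      have hhM'' : s(o, v) ∉ insert s(o, w) (M₁ \ {s(o, v)}) := fun h => by
        rcases mem_insert_iff.1 h with h | h
        · exact heh h
        · exact h.2 rfl
      have h1 := seriesMap_symmDiff (M₁ := insert s(o, w) (M₁ \ {s(o, v)})) ω hhω (mem_insert _ _) heω'' hhM''
      rw [seriesMap_cancel M₁ heM hhM heh] at h1
      rw [h1]
      exact ⟨fun h => hv'' _ (hsub.2 h) (Sym2.mem_mk_left _ _), hBF, hBQ⟩

/-- **`g` first, `h = ow` a FREE pair of the rest: the series bijection** onto the pinned reduced fibre `(M₁ ∖ {e, h}, u ∪ {h})`.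
[cite: CibulkaHladkyLaCroixWagner2008, Case 2(ii) (p. 4)] [cite: Linusson2011, Prop. 2.6] -/
theorem seriesEnd_first_eq_free (hov : o ≠ v) (hvw : v ≠ w) (how : o ≠ w) (heM : s(o, v) ∈ M₁) (hd : Disjoint u M₁)
    (hv : ∀ p ∈ M₁ ∪ u, v ∈ p → p = s(o, v)) (hhM : s(o, w) ∈ M₁)
    (P₀ Q : Set (BondConfig V))
    (hP₀ : ∀ ω ω' : BondConfig V, (∀ p, p ≠ s(o, v) → p ≠ s(o, w) → (p ∈ ω ↔ p ∈ ω')) → (ω ∈ P₀ ↔ ω' ∈ P₀)) :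
    fibreCount M₁ u ({ω | s(v, w) ∉ ω} ∩ ({ω | insert s(v, w) ω ∈ forestEv V} ∩ {ω | s(o, v) ∈ ω} ∩ P₀))
        ({ω | s(v, w) ∉ ω} ∩ (forestEv V ∩ Q)) =
      fibreCount (M₁ \ {s(o, v), s(o, w)}) (insert s(o, w) u) (forestEv V ∩ {ω | s(o, w) ∈ ω} ∩ P₀) (forestEv V ∩ Q) := by
  have heu : s(o, v) ∉ u := fun h => Set.disjoint_left.1 hd h heM
  have hhu : s(o, w) ∉ u := fun h => Set.disjoint_left.1 hd h hhM
  have heh : s(o, v) ≠ s(o, w) := fun h => hvw (Sym2.congr_right.1 h)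
  have hge : s(v, w) ≠ s(o, v) := fun h => by
    have : w ∈ s(o, v) := h ▸ Sym2.mem_mk_right _ _
    rcases Sym2.mem_iff.1 this with h' | h'
    · exact how h'.symm
    · exact hvw h'.symm
  have hv'' : ∀ p ∈ (M₁ \ {s(o, v), s(o, w)}) ∪ insert s(o, w) u, v ∉ p := by
    intro p hp hvp
    rcases hp with hp | hp
    · exact hp.2 (Or.inl (hv p (Or.inl hp.1) hvp))
    · rcases mem_insert_iff.1 hp with rfl | hp
      · rcases Sym2.mem_iff.1 hvp with h | h
        · exact hov h.symm
        · exact hvw h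
      · exact heu ((hv p (Or.inr hp) hvp) ▸ hp)
  refine fibreCount_eq_of_bij (fun ω => insert s(o, w) (ω \ {s(o, v)})) (fun ω => insert s(o, v) (ω \ {s(o, w)}))
    (fun ω hω hA hB => ?_) (fun ω hω hA hB => ?_)
  · -- forward
    obtain ⟨hgω, ⟨hgF, heω⟩, hP⟩ := hA
    obtain ⟨-, hBF, hBQ⟩ := hB
    have hgω : s(v, w) ∉ ω := hgω
    have heω : s(o, v) ∈ ω := heω
    have hgF : insert s(v, w) ω ∈ forestEv V := hgF
    have hve := end_only_of_fibre hv hω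
    have hωF : ω ∈ forestEv V := ((insert_mem_forestEv_iff hvw hgω).1 hgF).1
    have hvw' : ¬ (openGraph ω).Reachable v w := ((insert_mem_forestEv_iff hvw hgω).1 hgF).2
    -- `h = ow` is not in `ω` (else `v ~ o ~ w`)
    have hhω : s(o, w) ∉ ω := fun h => by
      have hmem : s(o, w) ∈ ω \ {s(o, v)} := ⟨h, fun h' => heh.symm (mem_singleton_iff.1 h')⟩
      have hadj : (openGraph (ω \ {s(o, v)})).Adj o w := (openGraph_adj _ _ _).2 ⟨hmem, how⟩
      exact hvw' ((reachable_end_iff hve heω w).2 (Or.inr hadj.reachable))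
    have how' : ¬ (openGraph (ω \ {s(o, v)})).Reachable o w := fun h =>
      hvw' ((reachable_end_iff hve heω w).2 (Or.inr h))
    have hF' : insert s(o, w) (ω \ {s(o, v)}) ∈ forestEv V :=
      (insert_mem_forestEv_iff how (fun h => hhω h.1)).2 ⟨forestEv_of_subset hωF sdiff_subset, how'⟩
    have hagree : ∀ p, p ≠ s(o, v) → p ≠ s(o, w) → (p ∈ ω ↔ p ∈ insert s(o, w) (ω \ {s(o, v)})) :=
      fun p hpe hph => (mem_seriesMap_iff hpe hph).symm
    refine ⟨?_, ⟨⟨hF', mem_insert _ _⟩, (hP₀ _ _ hagree).1 hP⟩, ?_, seriesMap_cancel ω heω hhω heh⟩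
    · rw [seriesMap_sdiff_free ω heω heM hhω hhM heh, hω]
    · rw [seriesMap_symmDiff_free ω heω heM hhω hhM heh]; exact ⟨hBF, hBQ⟩
  · -- backward
    obtain ⟨⟨hF'', hhω⟩, hP⟩ := hA
    obtain ⟨hBF, hBQ⟩ := hB
    have hhω : s(o, w) ∈ ω := hhω
    have hsubω : ω ⊆ (M₁ \ {s(o, v), s(o, w)}) ∪ insert s(o, w) u := (subset_union_of_fibre hω).1
    have heω'' : s(o, v) ∉ ω := fun h => by
      rcases hsubω h with h' | h'
      · exact h'.2 (Or.inl rfl)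
      · rcases mem_insert_iff.1 h' with h'' | h''
        · exact heh h''
        · exact heu h''
    have hgω'' : s(v, w) ∉ ω := fun h => hv'' _ (hsubω h) (Sym2.mem_mk_left _ _)
    have hviso : ∀ p ∈ ω \ {s(o, w)}, v ∉ p := fun p hp => hv'' p (hsubω hp.1)
    have hψF₀ : ω \ {s(o, w)} ∈ forestEv V := forestEv_of_subset hF'' sdiff_subset
    have hψF : insert s(o, v) (ω \ {s(o, w)}) ∈ forestEv V := by
      have := (isForestCfg_insert_of_isolated hviso hov.symm).2 hψF₀
      rwa [Sym2.eq_swap] at this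
    have hωeq : insert s(o, w) (ω \ {s(o, w)}) = ω := by rw [insert_sdiff_singleton, insert_eq_of_mem hhω]
    have how' : ¬ (openGraph (ω \ {s(o, w)})).Reachable o w :=
      ((insert_mem_forestEv_iff how (fun h => h.2 rfl)).1 (hωeq.symm ▸ hF'')).2
    have hve : ∀ p ∈ insert s(o, v) (ω \ {s(o, w)}), v ∈ p → p = s(o, v) := by
      intro p hp hvp
      rcases mem_insert_iff.1 hp with rfl | hp
      · rfl
      · exact absurd hvp (hviso p hp)
    have hge' : s(v, w) ∉ insert s(o, v) (ω \ {s(o, w)}) := fun h => by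
      rcases mem_insert_iff.1 h with h | h
      · exact hge h
      · exact hgω'' h.1
    have hrest : insert s(o, v) (ω \ {s(o, w)}) \ {s(o, v)} = ω \ {s(o, w)} := by
      rw [insert_sdiff_of_mem _ (mem_singleton (s(o, v))), sdiff_singleton_eq_self]
      exact fun h => heω'' h.1
    have hgF : insert s(v, w) (insert s(o, v) (ω \ {s(o, w)})) ∈ forestEv V := by
      refine (insert_mem_forestEv_iff hvw hge').2 ⟨hψF, fun hR => ?_⟩
      rcases (reachable_end_iff hve (mem_insert _ _) w).1 hR with h | h
      · exact hvw h.symm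
      · rw [hrest] at h
        exact how' h
    have hagree : ∀ p, p ≠ s(o, v) → p ≠ s(o, w) → (p ∈ insert s(o, v) (ω \ {s(o, w)}) ↔ p ∈ ω) :=
      fun p hpe hph => mem_seriesMap_iff hph hpe
    refine ⟨?_, ⟨hge', ⟨hgF, mem_insert _ _⟩, (hP₀ _ _ hagree).2 hP⟩, ?_, seriesMap_cancel ω hhω heω'' heh.symm⟩
    · rw [seriesMap_sdiff_back_free ω heω'' heM hhM heh, hω, insert_sdiff_of_mem _ (mem_singleton _),
        sdiff_singleton_eq_self hhu]
    · rw [seriesMap_symmDiff_back_free ω heω'' hhω heM hhM heh]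
      exact ⟨fun h => hv'' _ ((subset_union_of_fibre hω).2 h) (Sym2.mem_mk_left _ _), hBF, hBQ⟩

/-- **THE SERIES REDUCTION AT THE END `v`.**  Fibre `(M₁ ∪ {g}, u)`, `g = vw ∉ M₁` free, `e = ov, f = oy ∈ M₁`, `v` meeting only `e` and
`g`, `o, v, w, y` distinct except possibly… (`w ≠ y`, `o ≠ w`): the node's inequality on the fibre follows from the node's inequality
on the reduced fibre with hub pairs `ow, oy` — `(M₁ ∖ {e} ∪ {ow}, u)` if `ow` is new, `(M₁ ∖ {e, ow}, u ∪ {ow})` if `ow ∈ M₁`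
(nothing is needed if `ow` is pinned). [cite: CibulkaHladkyLaCroixWagner2008, Case 2(ii) (p. 4)] [cite: SempleWelsh2008, Conj. 1.1 (p. 2)]
[cite: Linusson2011, Prop. 2.6] -/
theorem adjForestNoSq_fibre_of_seriesEnd (hov : o ≠ v) (hvw : v ≠ w) (how : o ≠ w) (hwy : w ≠ y) (hvy : v ≠ y)
    (heM : s(o, v) ∈ M₁) (hgM : s(v, w) ∉ M₁) (hd : Disjoint u (insert s(v, w) M₁))
    (hv : ∀ p ∈ M₁ ∪ u, v ∈ p → p = s(o, v))
    (IHnew : s(o, w) ∉ M₁ → s(o, w) ∉ u →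
      fibreCount (insert s(o, w) (M₁ \ {s(o, v)})) u (forestEv V ∩ {ω | s(o, w) ∈ ω ∧ s(o, y) ∈ ω}) (forestEv V) ≤
        fibreCount (insert s(o, w) (M₁ \ {s(o, v)})) u (forestEv V ∩ {ω | s(o, w) ∈ ω}) (forestEv V ∩ {ω | s(o, y) ∈ ω}))
    (IHfree : s(o, w) ∈ M₁ →
      fibreCount (M₁ \ {s(o, v), s(o, w)}) (insert s(o, w) u) (forestEv V ∩ {ω | s(o, w) ∈ ω ∧ s(o, y) ∈ ω}) (forestEv V) ≤
        fibreCount (M₁ \ {s(o, v), s(o, w)}) (insert s(o, w) u) (forestEv V ∩ {ω | s(o, w) ∈ ω}) (forestEv V ∩ {ω | s(o, y) ∈ ω})) :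
    fibreCount (insert s(v, w) M₁) u (forestEv V ∩ {ω | s(o, v) ∈ ω ∧ s(o, y) ∈ ω}) (forestEv V) ≤
      fibreCount (insert s(v, w) M₁) u (forestEv V ∩ {ω | s(o, v) ∈ ω}) (forestEv V ∩ {ω | s(o, y) ∈ ω}) := by
  have hd₁ : Disjoint u M₁ := Disjoint.mono_right (subset_insert _ _) hd
  have hgu : s(v, w) ∉ u := fun h => Set.disjoint_left.1 hd h (mem_insert _ _)
  have hef : s(o, v) ≠ s(o, y) := fun h' => hvy (Sym2.congr_right.1 h')
  have hge : s(v, w) ≠ s(o, v) := fun h => by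
    have : w ∈ s(o, v) := h ▸ Sym2.mem_mk_right _ _
    rcases Sym2.mem_iff.1 this with h' | h'
    · exact how h'.symm
    · exact hvw h'.symm
  have hgf : s(v, w) ≠ s(o, y) := fun h => by
    have : v ∈ s(o, y) := h ▸ Sym2.mem_mk_left _ _
    rcases Sym2.mem_iff.1 this with h' | h'
    · exact hov h'.symm
    · exact hvy h'
  have hfh : s(o, y) ≠ s(o, w) := fun h => hwy (Sym2.congr_right.1 h).symm
  -- decompose by the class of `g`
  have hb0 : fibreCount (insert s(v, w) M₁) u (forestEv V ∩ {ω | s(o, v) ∈ ω ∧ s(o, y) ∈ ω}) (forestEv V) =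
      fibreCount (insert s(v, w) M₁) u (forestEv V ∩ {ω | s(o, v) ∈ ω ∧ s(o, y) ∈ ω}) (forestEv V ∩ univ) := by rw [inter_univ]
  rw [hb0, fibreCount_insert_one hgM, fibreCount_insert_one hgM]
  -- the `g`-second parts agree
  have h2 : fibreCount M₁ u ({ω | s(v, w) ∉ ω} ∩ (forestEv V ∩ {ω | s(o, v) ∈ ω ∧ s(o, y) ∈ ω}))
        ({ω | s(v, w) ∉ ω} ∩ {ω | insert s(v, w) ω ∈ forestEv V ∩ univ}) =
      fibreCount M₁ u ({ω | s(v, w) ∉ ω} ∩ (forestEv V ∩ {ω | s(o, v) ∈ ω}))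
        ({ω | s(v, w) ∉ ω} ∩ {ω | insert s(v, w) ω ∈ forestEv V ∩ {ω | s(o, y) ∈ ω}}) := by
    rw [inter_univ]; exact seriesEnd_second_eq hov hvw heM hef hgM hgu hv
  -- the `g`-first parts: read the events
  have hPbad : ∀ ω : BondConfig V, insert s(v, w) ω ∈ ({ω | s(o, v) ∈ ω ∧ s(o, y) ∈ ω} : Set (BondConfig V)) ↔
      ω ∈ ({ω | s(o, v) ∈ ω ∧ s(o, y) ∈ ω} : Set (BondConfig V)) := insert_mem_pairEv₂_iff hge hgf
  have hPgood : ∀ ω : BondConfig V, insert s(v, w) ω ∈ ({ω | s(o, v) ∈ ω} : Set (BondConfig V)) ↔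
      ω ∈ ({ω | s(o, v) ∈ ω} : Set (BondConfig V)) := insert_mem_pairEv_iff hge
  have h1b : fibreCount M₁ u ({ω | s(v, w) ∉ ω} ∩ {ω | insert s(v, w) ω ∈ forestEv V ∩ {ω | s(o, v) ∈ ω ∧ s(o, y) ∈ ω}})
        ({ω | s(v, w) ∉ ω} ∩ (forestEv V ∩ univ)) =
      fibreCount M₁ u ({ω | s(v, w) ∉ ω} ∩ ({ω | insert s(v, w) ω ∈ forestEv V} ∩ {ω | s(o, v) ∈ ω} ∩ {ω | s(o, y) ∈ ω}))
        ({ω | s(v, w) ∉ ω} ∩ (forestEv V ∩ univ)) := by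
    refine fibreCount_congr_fibre M₁ u fun ω _ => ?_
    constructor
    · rintro ⟨⟨hg, hF, hP⟩, hB⟩; exact ⟨⟨hg, ⟨hF, ((hPbad ω).1 hP).1⟩, ((hPbad ω).1 hP).2⟩, hB⟩
    · rintro ⟨⟨hg, ⟨hF, he⟩, hf⟩, hB⟩; exact ⟨⟨hg, hF, (hPbad ω).2 ⟨he, hf⟩⟩, hB⟩
  have h1g : fibreCount M₁ u ({ω | s(v, w) ∉ ω} ∩ {ω | insert s(v, w) ω ∈ forestEv V ∩ {ω | s(o, v) ∈ ω}})
        ({ω | s(v, w) ∉ ω} ∩ (forestEv V ∩ {ω | s(o, y) ∈ ω})) =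
      fibreCount M₁ u ({ω | s(v, w) ∉ ω} ∩ ({ω | insert s(v, w) ω ∈ forestEv V} ∩ {ω | s(o, v) ∈ ω} ∩ univ))
        ({ω | s(v, w) ∉ ω} ∩ (forestEv V ∩ {ω | s(o, y) ∈ ω})) := by
    refine fibreCount_congr_fibre M₁ u fun ω _ => ?_
    constructor
    · rintro ⟨⟨hg, hF, hP⟩, hB⟩; exact ⟨⟨hg, ⟨hF, (hPgood ω).1 hP⟩, mem_univ _⟩, hB⟩
    · rintro ⟨⟨hg, ⟨hF, he⟩, -⟩, hB⟩; exact ⟨⟨hg, hF, (hPgood ω).2 he⟩, hB⟩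
  have hP₀f : ∀ ω ω' : BondConfig V, (∀ p, p ≠ s(o, v) → p ≠ s(o, w) → (p ∈ ω ↔ p ∈ ω')) →
      (ω ∈ ({ω | s(o, y) ∈ ω} : Set (BondConfig V)) ↔ ω' ∈ ({ω | s(o, y) ∈ ω} : Set (BondConfig V))) :=
    fun ω ω' h => h _ hef.symm hfh
  have hP₀u : ∀ ω ω' : BondConfig V, (∀ p, p ≠ s(o, v) → p ≠ s(o, w) → (p ∈ ω ↔ p ∈ ω')) →
      (ω ∈ (univ : Set (BondConfig V)) ↔ ω' ∈ (univ : Set (BondConfig V))) := fun _ _ _ => by simp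
  rw [h1b, h1g, h2]
  -- three cases for the pair `h = ow`
  by_cases hhu : s(o, w) ∈ u
  · -- pinned: the `g`-first bad part is empty (triangle `o v w` in the first class)
    have z : fibreCount M₁ u ({ω | s(v, w) ∉ ω} ∩ ({ω | insert s(v, w) ω ∈ forestEv V} ∩ {ω | s(o, v) ∈ ω} ∩ {ω | s(o, y) ∈ ω}))
        ({ω | s(v, w) ∉ ω} ∩ (forestEv V ∩ univ)) = 0 := by
      refine fibreCount_eq_zero_of_forall _ _ _ _ fun ω hω hA _ => ?_
      obtain ⟨hg, ⟨hF, he⟩, -⟩ := hA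
      have hh : s(o, w) ∈ ω := by
        have : s(o, w) ∈ ω \ M₁ := hω.symm ▸ hhu
        exact this.1
      have hF' : IsForestCfg (insert s(v, w) ω) := hF
      refine not_mem_of_isForestCfg_of_two_mem hov.symm hvw how hF' (mem_insert_of_mem _ ?_) (mem_insert _ _)
        (mem_insert_of_mem _ hh)
      rwa [Sym2.eq_swap]
    rw [z]; omega
  by_cases hhM : s(o, w) ∈ M₁
  · rw [seriesEnd_first_eq_free hov hvw how heM hd₁ hv hhM {ω | s(o, y) ∈ ω} univ hP₀f,
      seriesEnd_first_eq_free hov hvw how heM hd₁ hv hhM univ {ω | s(o, y) ∈ ω} hP₀u]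
    have IH := IHfree hhM
    have e1 : fibreCount (M₁ \ {s(o, v), s(o, w)}) (insert s(o, w) u) (forestEv V ∩ {ω | s(o, w) ∈ ω} ∩ {ω | s(o, y) ∈ ω})
        (forestEv V ∩ univ) =
        fibreCount (M₁ \ {s(o, v), s(o, w)}) (insert s(o, w) u) (forestEv V ∩ {ω | s(o, w) ∈ ω ∧ s(o, y) ∈ ω}) (forestEv V) := by
      rw [inter_univ]; refine fibreCount_congr_fibre _ _ fun ω _ => ?_
      constructor
      · rintro ⟨⟨⟨hF, hh⟩, hf⟩, hB⟩; exact ⟨⟨hF, hh, hf⟩, hB⟩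
      · rintro ⟨⟨hF, hh, hf⟩, hB⟩; exact ⟨⟨⟨hF, hh⟩, hf⟩, hB⟩
    have e2 : fibreCount (M₁ \ {s(o, v), s(o, w)}) (insert s(o, w) u) (forestEv V ∩ {ω | s(o, w) ∈ ω} ∩ univ)
        (forestEv V ∩ {ω | s(o, y) ∈ ω}) =
        fibreCount (M₁ \ {s(o, v), s(o, w)}) (insert s(o, w) u) (forestEv V ∩ {ω | s(o, w) ∈ ω}) (forestEv V ∩ {ω | s(o, y) ∈ ω}) := by
      rw [inter_univ]
    rw [e1, e2]; omega
  · have hhu' : s(o, w) ∉ u := hhu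
    rw [seriesEnd_first_eq_new hov hvw how heM hd₁ hv hhM hhu' {ω | s(o, y) ∈ ω} univ hP₀f,
      seriesEnd_first_eq_new hov hvw how heM hd₁ hv hhM hhu' univ {ω | s(o, y) ∈ ω} hP₀u]
    have IH := IHnew hhM hhu'
    have e1 : fibreCount (insert s(o, w) (M₁ \ {s(o, v)})) u (forestEv V ∩ {ω | s(o, w) ∈ ω} ∩ {ω | s(o, y) ∈ ω})
        (forestEv V ∩ univ) =
        fibreCount (insert s(o, w) (M₁ \ {s(o, v)})) u (forestEv V ∩ {ω | s(o, w) ∈ ω ∧ s(o, y) ∈ ω}) (forestEv V) := by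
      rw [inter_univ]; refine fibreCount_congr_fibre _ _ fun ω _ => ?_
      constructor
      · rintro ⟨⟨⟨hF, hh⟩, hf⟩, hB⟩; exact ⟨⟨hF, hh, hf⟩, hB⟩
      · rintro ⟨⟨hF, hh, hf⟩, hB⟩; exact ⟨⟨⟨hF, hh⟩, hf⟩, hB⟩
    have e2 : fibreCount (insert s(o, w) (M₁ \ {s(o, v)})) u (forestEv V ∩ {ω | s(o, w) ∈ ω} ∩ univ)
        (forestEv V ∩ {ω | s(o, y) ∈ ω}) =
        fibreCount (insert s(o, w) (M₁ \ {s(o, v)})) u (forestEv V ∩ {ω | s(o, w) ∈ ω}) (forestEv V ∩ {ω | s(o, y) ∈ ω}) := by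
      rw [inter_univ]
    rw [e1, e2]; omega

end SeriesEnd

end FK
end Summit.CriticalPhenomena.PercolationContinuityZ3.Theorems

end
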